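import Summits.AtomisticToContinuum.BoseEinsteinCondensation.Theorems.BECCutLineWeakDisorderAcrossCutDefs
import Summits.AtomisticToContinuum.BoseEinsteinCondensation.Theorems.BECCutLineWeakDisorderTwoReplicaTransienceBoundSandwich
import HarnessLib

/-!
# Route `BECCutLineWeakDisorder`, crux `TwoReplicaTransienceBound` (stmt-AtomisticToContinuum-9687):
# finiteness of the tilted across-cut moments (line `across-cut-thinning`, toolbox)

Registered toolbox stub `stub_crossTiltLe` of the line `across-cut-thinning` (v2, vocabulary
`Theorems/BECCutLineWeakDisorderAcrossCutDefs.lean`): for a BOUNDED pair potential `v ≤ C` the tilted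
across-cut moments `crossTilt s t i j = Λ_{s,t}[A^i A'^j]` are dominated by the bath-only `2T`-bridge
mass,

  `crossTilt s t i j ≤ (n·C·T)^{i+j} · bathTwo`  (`T` read through `ENNReal.ofReal`, so all real `T`),

because the dose painted by a frozen tagged path on the `n` bath lines during `[0, T]` is at most
`n·C·T` (`TracerDecoupling.taggedBathAction_le_of_le`), the tilt factor `e^{-sA}` is `≤ 1`
(`expNeg_le_one`) and `∫ fkWeight dW_n = Z_n(Y)` (`fkPartition`). Together with
`bathTwo ≤ |Λ_L^n| < ∞` for `T ≥ 0` (`Z_n ≤ 𝟙_{Λ^n}`) this is exactly the finiteness the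
instantiation of the abstract tilt device `TiltFTC` on the two-sided bath space needs
(`stub_blockOfCovariance`: the `[0,∞]`-valued `crossTilt` are then real numbers `tiltLaplace`).
Also recorded: the one-sided bound `sideFactor s i ≤ (nCT)^i Z_n(Y)`, the sharper two-sided bound
`crossTilt s t i j ≤ (nCT)^{i+j} crossTilt s t 0 0` (moments of the tilted law against its own mass)
and `crossTilt s t 0 0 ≤ bathTwo` (tilting only loses mass).

Nothing here is conjectural; the conjecture ITEM of the line (`CrossCovarianceBoundBdd`, registered
stub `stub_crossCovarianceBdd`: an `n`-UNIFORM bound on the tilted across-cut dose covariance) is NOT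
touched — these bounds are per `(n, T)` and grow like `(nCT)^{i+j}`.

Reference (for the objects only): K. L. Chung, Z. Zhao, *From Brownian Motion to Schrödinger's
Equation* (1995), §3.2–3.3 (sub-Markov Feynman–Kac functionals of killed Brownian motion).
-/

noncomputable section

open MeasureTheory Filter Set Finset
open scoped ENNReal NNReal Topology BigOperators

namespace Summit.AtomisticToContinuum.BoseEinsteinCondensation.Cruxes.TwoReplicaTransienceBound.AcrossCutThinning

open Literature.MathematicalPhysics.QuantumManyBody.BoseGas
open Summit.AtomisticToContinuum.BoseEinsteinCondensation.Cruxes.TwoReplicaTransienceBound.TracerDecoupling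

variable {n : ℕ}

/-! ### The registered toolbox signature -/

namespace Goal

/-- Registered toolbox stub `stub_crossTiltLe`: for a bounded pair potential `v ≤ C` (`C : ℝ≥0`),
every tilted across-cut moment is at most `(n·C·T)^{i+j}` times the bath-only `2T`-bridge mass:
`crossTilt s t i j ≤ (n C T)^{i+j} · bathTwo` (all tilts `s, t`, all junctions and frozen tagged
paths, all real `L, T`; `T` enters the constant through `ENNReal.ofReal`). -/
abbrev stub_crossTiltLe : Prop :=
  ∀ (n : ℕ) (v : ℝ → ℝ≥0∞) (C : ℝ≥0), (∀ r, v r ≤ C) → ∀ (L T : ℝ) (s t : ℝ≥0) (i j : ℕ)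
    (x x' : Space) (ω₀ ω₀' : Fin 3 → (ℝ≥0 → ℝ)),
    crossTilt (n := n) s t i j v L T x ω₀ x' ω₀' ≤
      ((n : ℝ≥0∞) * (C : ℝ≥0∞) * ENNReal.ofReal T) ^ (i + j) * bathTwo v L T n

end Goal

/-! ### The dose ceiling -/

/-- The dose ceiling `n·C·T` (as an extended nonnegative real) is finite. -/
theorem doseCeiling_ne_top (n : ℕ) (C : ℝ≥0) (T : ℝ) :
    (n : ℝ≥0∞) * (C : ℝ≥0∞) * ENNReal.ofReal T ≠ ⊤ :=
  ENNReal.mul_ne_top (ENNReal.mul_ne_top (ENNReal.natCast_ne_top n) ENNReal.coe_ne_top)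
    ENNReal.ofReal_ne_top

/-! ### One-sided bounds -/

/-- Moments against mass, one side: `E_Y[w A^i e^{-sA}] ≤ (nCT)^i · E_Y[w e^{-sA}]`, i.e.
`sideFactor s i ≤ (nCT)^i · sideFactor s 0`. -/
theorem sideFactor_le_pow_mul_sideFactor_zero {v : ℝ → ℝ≥0∞} {C : ℝ≥0} (hC : ∀ r, v r ≤ C)
    (s : ℝ≥0) (i : ℕ) (L T : ℝ) (x : Space) (Y : Config n) (ω₀ : Fin 3 → (ℝ≥0 → ℝ)) :
    sideFactor s i v L T x Y ω₀ ≤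
      ((n : ℝ≥0∞) * (C : ℝ≥0∞) * ENNReal.ofReal T) ^ i * sideFactor s 0 v L T x Y ω₀ := by
  unfold sideFactor
  rw [← lintegral_const_mul' _ _ (ENNReal.pow_ne_top (doseCeiling_ne_top n C T))]
  refine lintegral_mono fun ωb => ?_
  rw [pow_zero, one_mul, mul_left_comm]
  exact mul_le_mul' (pow_le_pow_left' (taggedBathAction_le_of_le hC T x Y ω₀ ωb) i) le_rfl

/-- Tilting only loses mass, one side: `E_Y[w e^{-sA}] ≤ E_Y[w] = Z_n(Y)`, i.e.
`sideFactor s 0 ≤ fkPartition`. -/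
theorem sideFactor_zero_le_fkPartition (v : ℝ → ℝ≥0∞) (s : ℝ≥0) (L T : ℝ) (x : Space)
    (Y : Config n) (ω₀ : Fin 3 → (ℝ≥0 → ℝ)) :
    sideFactor s 0 v L T x Y ω₀ ≤ fkPartition v L T Y := by
  rw [← sideFactor_zero_zero v L T x Y ω₀]
  unfold sideFactor
  refine lintegral_mono fun ωb => mul_le_mul' le_rfl ?_
  simp only [pow_zero, one_mul, ENNReal.coe_zero, zero_mul, expNeg_zero]
  exact expNeg_le_one _

/-- The one-sided tilted factor against the bare bath: `sideFactor s i ≤ (nCT)^i · Z_n(Y)` for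
`v ≤ C`. -/
theorem sideFactor_le {v : ℝ → ℝ≥0∞} {C : ℝ≥0} (hC : ∀ r, v r ≤ C) (s : ℝ≥0) (i : ℕ) (L T : ℝ)
    (x : Space) (Y : Config n) (ω₀ : Fin 3 → (ℝ≥0 → ℝ)) :
    sideFactor s i v L T x Y ω₀ ≤
      ((n : ℝ≥0∞) * (C : ℝ≥0∞) * ENNReal.ofReal T) ^ i * fkPartition v L T Y :=
  (sideFactor_le_pow_mul_sideFactor_zero hC s i L T x Y ω₀).trans
    (mul_le_mul' le_rfl (sideFactor_zero_le_fkPartition v s L T x Y ω₀))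

/-- The one-sided tilted factor is at most `(nCT)^i` (since `Z_n(Y) ≤ 1`); in particular finite. -/
theorem sideFactor_le_pow {v : ℝ → ℝ≥0∞} {C : ℝ≥0} (hC : ∀ r, v r ≤ C) (s : ℝ≥0) (i : ℕ)
    (L T : ℝ) (x : Space) (Y : Config n) (ω₀ : Fin 3 → (ℝ≥0 → ℝ)) :
    sideFactor s i v L T x Y ω₀ ≤ ((n : ℝ≥0∞) * (C : ℝ≥0∞) * ENNReal.ofReal T) ^ i :=
  (sideFactor_le hC s i L T x Y ω₀).trans
    ((mul_le_mul' le_rfl (fkPartition_le_one v L T Y)).trans_eq (mul_one _))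

/-- Finiteness of the one-sided tilted factor for bounded `v`. -/
theorem sideFactor_ne_top {v : ℝ → ℝ≥0∞} {C : ℝ≥0} (hC : ∀ r, v r ≤ C) (s : ℝ≥0) (i : ℕ)
    (L T : ℝ) (x : Space) (Y : Config n) (ω₀ : Fin 3 → (ℝ≥0 → ℝ)) :
    sideFactor s i v L T x Y ω₀ ≠ ⊤ :=
  ne_top_of_le_ne_top (ENNReal.pow_ne_top (doseCeiling_ne_top n C T))
    (sideFactor_le_pow hC s i L T x Y ω₀)

/-! ### Two-sided bounds -/

/-- **Moments against mass** (two-sided): `Λ_{s,t}[A^i A'^j] ≤ (nCT)^{i+j} Λ_{s,t}[1]`, i.e.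
`crossTilt s t i j ≤ (nCT)^{i+j} · crossTilt s t 0 0`, for `v ≤ C`. -/
theorem crossTilt_le_pow_mul_crossTilt_zero {v : ℝ → ℝ≥0∞} {C : ℝ≥0} (hC : ∀ r, v r ≤ C)
    (s t : ℝ≥0) (i j : ℕ) (L T : ℝ) (x : Space) (ω₀ : Fin 3 → (ℝ≥0 → ℝ)) (x' : Space)
    (ω₀' : Fin 3 → (ℝ≥0 → ℝ)) :
    crossTilt (n := n) s t i j v L T x ω₀ x' ω₀' ≤
      ((n : ℝ≥0∞) * (C : ℝ≥0∞) * ENNReal.ofReal T) ^ (i + j) *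
        crossTilt (n := n) s t 0 0 v L T x ω₀ x' ω₀' := by
  unfold crossTilt
  rw [← lintegral_const_mul' _ _ (ENNReal.pow_ne_top (doseCeiling_ne_top n C T))]
  refine lintegral_mono fun Y => ?_
  calc sideFactor s i v L T x Y ω₀ * sideFactor t j v L T x' Y ω₀'
      ≤ ((n : ℝ≥0∞) * (C : ℝ≥0∞) * ENNReal.ofReal T) ^ i * sideFactor s 0 v L T x Y ω₀ *
          (((n : ℝ≥0∞) * (C : ℝ≥0∞) * ENNReal.ofReal T) ^ j * sideFactor t 0 v L T x' Y ω₀') :=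
        mul_le_mul' (sideFactor_le_pow_mul_sideFactor_zero hC s i L T x Y ω₀)
          (sideFactor_le_pow_mul_sideFactor_zero hC t j L T x' Y ω₀')
    _ = ((n : ℝ≥0∞) * (C : ℝ≥0∞) * ENNReal.ofReal T) ^ (i + j) *
          (sideFactor s 0 v L T x Y ω₀ * sideFactor t 0 v L T x' Y ω₀') := by
        rw [pow_add]; ring

/-- **Tilting only loses mass** (two-sided): `Λ_{s,t}[1] ≤ Λ_{0,0}[1] = ∫ Z_n²`, i.e.
`crossTilt s t 0 0 ≤ bathTwo`. -/
theorem crossTilt_zero_le_bathTwo (v : ℝ → ℝ≥0∞) (s t : ℝ≥0) (L T : ℝ) (x : Space)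
    (ω₀ : Fin 3 → (ℝ≥0 → ℝ)) (x' : Space) (ω₀' : Fin 3 → (ℝ≥0 → ℝ)) :
    crossTilt (n := n) s t 0 0 v L T x ω₀ x' ω₀' ≤ bathTwo v L T n := by
  unfold crossTilt bathTwo
  refine lintegral_mono fun Y => ?_
  rw [sq]
  exact mul_le_mul' (sideFactor_zero_le_fkPartition v s L T x Y ω₀)
    (sideFactor_zero_le_fkPartition v t L T x' Y ω₀')

/-- PROVED toolbox stub `stub_crossTiltLe`: `crossTilt s t i j ≤ (nCT)^{i+j} · bathTwo` for `v ≤ C`. -/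
theorem stub_crossTiltLe : Goal.stub_crossTiltLe := by
  intro n v C hC L T s t i j x x' ω₀ ω₀'
  exact (crossTilt_le_pow_mul_crossTilt_zero hC s t i j L T x ω₀ x' ω₀').trans
    (mul_le_mul' le_rfl (crossTilt_zero_le_bathTwo v s t L T x ω₀ x' ω₀'))

/-! ### Finiteness of the bath-only mass and of all tilted moments (`T ≥ 0`) -/

/-- The bath-only `2T`-bridge mass is at most the volume of the `n`-particle box for `T ≥ 0`
(`Z_n ≤ 1` on the box, `Z_n = 0` off it by Dirichlet killing at time `0`). For `T < 0` this fails
(`Z_n ≡ 1`, `bathTwo = ∞`), whence the hypothesis. -/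
theorem bathTwo_le_volume (v : ℝ → ℝ≥0∞) (L : ℝ) {T : ℝ} (hT : 0 ≤ T) (n : ℕ) :
    bathTwo v L T n ≤ volume (boxN n L) := by
  unfold bathTwo
  calc ∫⁻ Y : Config n, fkPartition v L T Y ^ 2
      ≤ ∫⁻ Y : Config n, (boxN n L).indicator 1 Y := lintegral_mono fun Y => by
        by_cases hY : Y ∈ boxN n L
        · rw [Set.indicator_of_mem hY, Pi.one_apply]
          exact (pow_le_pow_left' (fkPartition_le_one v L T Y) 2).trans_eq (one_pow 2)
        · rw [Set.indicator_of_notMem hY, fkPartition, fkSemigroup_of_notMem v hT _ hY]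
          simp
    _ = volume (boxN n L) := lintegral_indicator_one (measurableSet_boxN n L)

/-- The bath-only `2T`-bridge mass is finite for `T ≥ 0`. -/
theorem bathTwo_ne_top (v : ℝ → ℝ≥0∞) (L : ℝ) {T : ℝ} (hT : 0 ≤ T) (n : ℕ) :
    bathTwo v L T n ≠ ⊤ :=
  ne_top_of_le_ne_top (volume_boxN_lt_top n L).ne (bathTwo_le_volume v L hT n)

/-- Every tilted across-cut moment is finite for bounded `v` and `T ≥ 0`. -/
theorem crossTilt_ne_top {v : ℝ → ℝ≥0∞} {C : ℝ≥0} (hC : ∀ r, v r ≤ C) (s t : ℝ≥0) (i j : ℕ)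
    (L : ℝ) {T : ℝ} (hT : 0 ≤ T) (x : Space) (ω₀ : Fin 3 → (ℝ≥0 → ℝ)) (x' : Space)
    (ω₀' : Fin 3 → (ℝ≥0 → ℝ)) :
    crossTilt (n := n) s t i j v L T x ω₀ x' ω₀' ≠ ⊤ :=
  ne_top_of_le_ne_top
    (ENNReal.mul_ne_top (ENNReal.pow_ne_top (doseCeiling_ne_top n C T)) (bathTwo_ne_top v L hT n))
    (stub_crossTiltLe n v C hC L T s t i j x x' ω₀ ω₀')

end Summit.AtomisticToContinuum.BoseEinsteinCondensation.Cruxes.TwoReplicaTransienceBound.AcrossCutThinning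

end
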